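import Mathlib.AlgebraicGeometry.EllipticCurve.LFunction
import Literature.NumberTheory.EllipticCurves.NewformAbelianVariety
import Literature.AlgebraicGeometry.Motives.AbelianVarietyBaseChange
import Literature.NumberTheory.DiophantineGeometry.AVGeomPointsDivisibleProofs
import Literature.NumberTheory.EllipticCurves.HeegnerPointsOfConductor
import HarnessLib

/-!
# W. Zhang's level-raised Kolyvagin data: `g_m`, `A_m`, `A_m[𝔭_m] ≃ E[p]`, the Heegner points
# `y_m(n) ∈ A_m(K[n])` and the level-raised Kolyvagin classes `c(n, m) ∈ H¹(K, E[p])`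

Topic `Literature/NumberTheory/EllipticCurves` (the OBJECT-LEVEL vocabulary behind definition item
`defn-ZhangLevelRaisedKolyvaginData`, for crux stmt-BirchSwinnertonDyer-19574 of route `KolyvaginRoadThree`, cell
`bsd-stepL`). DEFINITIONS ONLY, with elementary proved API: no named fact, no `sorry`, no instance, no notation.
COMPANION of `ZhangLevelRaisedKolyvaginData.lean` (same directory), which records the level-raised classes
`(m, n) ↦ c(n, m) ∈ H¹(K, E[p])` and residual eigensystems for all levels at once as FREE data constrained only at
the bottom (`c(1, 1) = δ y_K`): here, at ONE level `m`, the classes are CONSTRUCTED (`levelRaisedClass`) from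
object-level data — the newform `g_m`, the abelian variety `A_m` with `A_m[p]/𝔭 ≃ E[p]`, and the Heegner points
`y_m(n) ∈ A_m(K[n])` — so that statements about `c(n, m)` (Thm. 4.3, Thm. 7.2, Lemma 8.4) concern PINNED classes. Source: Wei Zhang, *Selmer groups and
the indivisibility of Heegner points*, Camb. J. Math. **2** (2014) 191–253 [WZhang2014] (held publisher text
`paper:doi-10-4310-cjm-2014-v2-n2-a2`, printed page = file number + 190), "Notations" (iv)–(ix), (xii)–(xiv)
(pp. 200–202), Thm. 2.1 and the paragraph after its proof (pp. 203–204), §3.2 (3.2), Remarks 6–7 (pp. 205–206),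
§3.7 (3.20)–(3.22) (pp. 211–213), §3.9 Lemma 3.3, (3.29)–(3.30), Remarks 8–9 (pp. 214–216), §4.2 Thm. 4.3
(p. 218). NOTATION: as in the source, `m` is the LEVEL-RAISING index (a square-free product of admissible primes,
`m ∈ Λ'`; the level of `g_m` is `N m`) and `n` is the KOLYVAGIN CONDUCTOR (a square-free product of Kolyvagin
primes, `n ∈ Λ`; the Heegner point `x_m(n)` is defined over the ring class field `K[n]`); the item text has the
two letters interchanged.

## What W. Zhang defines (verbatim) and how it is recorded

* **Level raising** (Thm. 2.1, p. 203, Ribet / Diamond–Taylor): *"Let `g` be a newform of weight two of level `N`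
  (and trivial nebentypus). Let `𝔭` be a prime of `𝒪_g` such that `ρ̄_{g,𝔭}` is irreducible with residue
  characteristic `p ≥ 5`. Then for each admissible prime `q`, there exists a newform `g'` of level `N q` (and
  trivial nebentypus), with a prime `𝔭'` of `𝒪_{g'}` and `𝒪_{g',0}/𝔭'₀ ≃ 𝒪_{g,0}/𝔭₀ = k₀` such that
  `ρ̄_{g,𝔭₀} ≃ ρ̄_{g',𝔭'₀}`. Equivalently, for all primes `ℓ ≠ q`, we have `a_ℓ(g) mod 𝔭 ≡ a_ℓ(g') mod 𝔭'`,
  where both sides lie in `k₀`"*; p. 204: *"Let `m ∈ Λ'` be a product of distinct admissible primes. By Theorem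
  2.1, we obtain a weight-two newform `g_m` of level `N m` together with a prime `𝔭_m` of `𝒪_{g_m}`. … We have the
  residue field `k_m = 𝒪_{g_m}/𝔭_m` and isomorphic subfields `k₀ = 𝒪_{g,0}/𝔭₀ ≃ 𝒪_{g_m,0}/𝔭_{m,0}`. The
  isomorphism will be fixed in the rest of the paper"*; Notations (vi): *"We denote by `𝒪₀ ⊂ 𝒪` the order
  generated over `ℤ` by the Fourier coefficients `aₙ(g)`'s of `g`. Let `𝔭₀ = 𝔭 ∩ 𝒪₀`, and
  `k₀ := 𝒪₀/𝔭₀`"*, (ix): *"This impose strong conditions on `k₀` and indeed implies that `k₀ = 𝔽_p`"*. For the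
  newform `g = f_E` of an elliptic curve `E/ℚ` (`𝒪_g = ℤ`, `𝔭 = (p)`, `a_ℓ(g) = a_ℓ(E)`) this is RECORDED as the
  fields `g`, `isNewform` (tree `IsNewform0`: new, normalised Hecke eigenform on `Γ₀(N m)`), `𝔭` (an ideal of
  the tree's coefficient order `coeffOrder g = ℤ[{aₙ(g)}] = 𝒪_{g_m,0}`), `natCast_mem` (`p ∈ 𝔭_{m,0}`),
  `one_not_mem`, `exists_int_sub_mem` (`k_{m,0} = 𝔽_p`: every residue is an integer residue; with the two
  previous fields and `p` prime, `𝔭_{m,0}` is then a maximal ideal of residue field `ℤ/p`, canonically — no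
  isomorphism to fix)
  and `coeff_sub_mem`: `a_ℓ(g_m) ≡ a_ℓ(E) (mod 𝔭_{m,0})` for every prime `ℓ ∤ N m p`, with `a_ℓ(E)` Mathlib's
  `WeierstrassCurve.LFunction W ℓ` (the `ℓ`-th Dirichlet coefficient of `L(E, s)`, model-independent). The
  congruence is recorded AWAY FROM `N m p` only (the printed "for all primes `ℓ ≠ q`" also covers `ℓ ∣ N p`); the
  full isomorphism `ρ̄_{g_m} ≃ ρ̄_g` is the field `ι` below. EXISTENCE of such `g_m` (Thm. 2.1, `p ≥ 5`,
  admissible `q`) is NOT part of the structure.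
* **The abelian variety** (Notations (vii), §3.2, §3.7, §3.9): *"`A = A_g`: a GL₂-type abelian variety over `ℚ`
  attached to `g`, unique up to isogeny. We always choose an isomorphism class `A` with an embedding
  `𝒪 ↪ End_ℚ(A)`"*; *"Let `m ∈ Λ'⁺` and `A_m = A_{g_m}` a quotient of the Jacobian `J(X_m)`"*; Lemma 3.3 (Helm),
  (3.29): *"`J(X_m)[𝔪_m] ≃ V ≃ A⁰_{g_m}[𝔭_{m,0}]`, where all vector spaces are 2-dimensional over `k₀`"* (`V` the
  Galois module of `ρ̄_{g,𝔭₀}`, here `V = E[p]`); Remark 9: *"we will also view `c(n, m) ∈ H¹(K, V)` as a class in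
  `H¹(K, V ⊗_{k₀} k)` by identifying `A[𝔭] ≃ V ⊗_{k₀} k`"*. RECORDED as `av : NewformAbelianVariety g` (the tree's
  interface for Shimura's couple `(A_{g_m}, θ : ℤ[{aₙ}] → End_ℚ A)`, file `NewformAbelianVariety.lean`) and the
  identification `ι : A_m(K̄)[p] → E(K̄)[p]` of `Γ_K`-modules (`ι_smul`), `𝒪_{g_m,0}`-semilinear modulo `𝔭_{m,0}`
  (`ι_hecke`: it kills `𝔭_{m,0} · A_m[p]`), onto (`ι_surjective`) and with kernel `𝔭_{m,0} · A_m[p]`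
  (`mem_of_ι_eq_zero`), i.e. an isomorphism `A_m[p] ⊗_{𝒪_{g_m,0}} k_{m,0} ≃ E[p]`. DESIGN (why the quotient
  `A_m[p]/𝔭 A_m[p]` and not the submodule `A_m[𝔭]`): W. Zhang's classes live in `H¹(K, A_{g,1})` with
  `A_{g,M} = T_𝔭 A_g ⊗_{𝒪_𝔭} 𝒪_𝔭/𝔭^M` (p. 211), and `A_{g,1} = T_𝔭 A/𝔭 T_𝔭 A = A[p]/𝔭 A[p]` canonically; it is
  through this QUOTIENT of `A_m[p]` that the Kummer classes of points (cocycles `σ ↦ σQ − Q`, `pQ = P`, valued in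
  `A_m[p]`) are pushed to `H¹(K, V)`. For `A` with `𝒪_{g_m}`-multiplication the quotient is isomorphic to the
  submodule `A[𝔭]` of (viii)/(3.29) (canonically up to a unit of `k` — multiplication by `p/ϖ`, `ϖ` a
  uniformiser at `𝔭`), and W. Zhang's classes are themselves normalised only up to units of `k₀` (Thm. 4.3: *"up
  to a unit in `k₀`"*; Remark 8); precisely, `A_{g,1} = (A[p]/𝔭₀A[p]) ⊗_{k₀} k` with `k₀ = 𝔽_p` here, and the
  `k₀`-structure `A[p]/𝔭₀A[p]` is Zhang's `V`. All points are taken in `K̄ = AlgebraicClosure K` (the tree's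
  `H¹(K, E[p]) = galH1Torsion (W.baseChange K) p` lives there), on the base change `(A_m)_K`
  (`AbelianVariety.baseChange`), with the Hecke action transported (`NewformAbelianVariety.heckePointsOver`). Only
  `Γ_K`-equivariance of `ι` is recorded, not the `Gal(ℚ̄/ℚ)`-equivariance of (3.29) (the `K`-scheme points
  `(A_m)_K(K̄)` carry no action of `Aut(K̄/ℚ)` in the tree); statements about the complex-conjugation sign of
  `c(n, m)` (§3.7, `c_M(n) ∈ H¹(K, A_{g,M})^{ε_ν(n)}`, a theorem about CM points) take what they need as hypotheses.
* **Heegner points and derived classes** (§3.2 p. 205: *"Let `n ∈ Λ` be a product of Kolyvagin primes. We now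
  define a system of points defined over the ring class field `K[n]`: `x_m(n) ∈ X_m(K[n])`, `y_m(n) ∈ A_m(K[n])`"*,
  (3.2), Remark 6 on the normalisation `ỹ_m(n) = (ℓ₀ + 1 − T_{ℓ₀}) x_m(n) / (ℓ₀ + 1 − a_{ℓ₀}(g_m))`; §3.7 pp. 212–213:
  *"Choose a generator `σ_ℓ` of `G_ℓ`, and define the Kolyvagin derivative operator `D_ℓ := Σ_{i=1}^{ℓ} i σ_ℓ^i`,
  `D_n := ∏_{ℓ∣n} D_ℓ`. Fix a set `𝒢` of representatives of `𝒢_n/G_n`. Then we define the derived Heegner point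
  `P(n) := Σ_{σ ∈ 𝒢} σ(D_n y(n))`. … the Kummer image of `P(n)` descends to a cohomology class denoted by (3.21)
  `c_M(n) ∈ H¹(K, A_{g,M})`"*; (3.22) `y_K := P(1) = tr_{K[1]/K} y(1)`; §3.9 (3.30): *"we now define the Kolyvagin
  cohomology class `c(n, m) ∈ H¹(K, J(X_m)[𝔪_m]) ≃ H¹(K, V)` as the derived cohomological class from the Heegner
  point `x_m(n) ∈ X_m(K[n])` and `y_m(n) ∈ A⁰_{g_m}(K[n])`"*; Remark 8: *"The classes `c(n, m)` depend on the choice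
  of the level-raising newform `g_m` of level `N m`, and the choice of the generators `σ_ℓ`'s made in §3.7"*;
  p. 220: *"We have also chosen the derivative operators `D_n` compatibly when varying `m`"*. RECORDED as: the
  field `y : ℕ → A_m(K̄)` with `smul_y` (`y_m(n)` is fixed by `Gal(K̄/K[n])`, i.e. lies in `A_m(K[n])`; the ring
  class field `K[n]` is the tree's `ringClassField K ι₀ n ⊆ ℂ`, seen in `K̄` through ALL its `K`-embeddings, which
  have the same image — `ringClassStabilizer`); the Kolyvagin CHOICES at conductor `n` as a separate structure
  `RingClassKolyvaginChoice K ι₀ n` (lifts to `Γ_K` of the generators `σ_ℓ` and of the representatives `𝒢`),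
  passed as an ARGUMENT to the derived objects so that data at different levels `m` use the same choices by
  construction; the derived point `derivedPoint = P_m(n)` (the tree's generic `KolyvaginOperator.derivedPoint`,
  shared with the elliptic-curve classes of `HeegnerPointsOfConductor.lean`); and the class
  `levelRaisedClass = c(n, m) ∈ H¹(K, E[p])`, DEFINED as the unique class whose restriction to `Gal(K̄/K[n])` is
  represented by the Kummer cocycle `h ↦ ι(hQ − Q)` of a `p`-th root `Q` of `P_m(n)` (`IsLevelRaisedClassOf`;
  Gross 1991 (4.4): *"Let `c(n)` be the unique class in `H¹(K, E_p)` such that `Res c(n) = δ_n [P_n]`"*; Zhang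
  (3.21) "descends"), with the junk value `0` when such a class does not exist uniquely (it does when
  `E(K[n])[p] = 0` and the Kummer image is `𝒢_n`-invariant — Zhang p. 212: *"When `M ≤ M(n)`, the Kummer image of
  `P(n)` … is actually `Gal(K[n]/K)`-invariant … `A_{g,M}^{Gal_{K[n]}} = 0`. Hence the restriction map … is an
  isomorphism"*; these are theorems about the data, not recorded).
* NOT RECORDED (deliberately; the requester's "existence is NOT part of the definition"): that `y_m(n)` IS the
  image of the CM point `x_m(n)` of conductor `n` on the Shimura curve `X_m = X_{N⁺,N⁻m}` ((3.4)–(3.7)) under a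
  parametrisation `J(X_m) → A_m` — the tree has Shimura curves only complex-analytically (`ShimuraCurveData`,
  `Literature/NumberTheory/Automorphic/ShimuraCurve.lean`) and no Jacobian or uniformisation of `A_m`, so the
  CM provenance of `y` cannot be stated; exactly as the elliptic-curve datum `KolyvaginHeegnerData` takes
  `y(n) ∈ E(K[n])` as DATA (there pinned to `φ(x(n))` through the complex parametrisation of `X₀(N)`, which has no
  analogue for `dim A_m > 1`). `-- TODO(general form): the Heegner provenance of y_m(n) on X_{N⁺,N⁻m}`. Also not
  recorded: the parity `ν(N⁻m)` even / admissibility of the primes of `m` / `(m, N D p) = 1` (hypotheses of the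
  FACTS over this structure — at `p = 3` Bertolini–Darmon admissible primes do not exist,
  `BertoliniDarmon2005.not_isAdmissiblePrime_three`, and the consumer cell uses its own notion), the reciprocity
  law Thm. 4.3, the base case Thm. 7.2, Lemma 8.4, Kolyvagin's conjecture — all statements ABOUT
  `levelRaisedClass`, to be typed over this file; and the definite side (`ν(N⁻m)` odd: the Shimura SET `X_m`, the
  `k₀`-valued eigenform `φ` of (4.7), the special value (6.6)) — `-- TODO(general form): ZhangLevelRaisedDefiniteData`.

## Contents

* `ringClassStabilizer K ι₀ n d ≤ Γ_K` — the automorphisms of `K̄/K` fixing (every `K`-embedded image of) the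
  elements of `K[n]` that lie in `K[d]`; `d = n`: `Gal(K̄/K[n])`; `d = n/ℓ`: the lifts of `G_ℓ = Gal(K[n]/K[n/ℓ])`;
  normal in `Γ_K` (`ringClassStabilizer_normal`). `AgreeOnRingClass K ι₀ n d γ δ`: `γ, δ` agree on those elements.
* `RingClassKolyvaginChoice K ι₀ n` — `σ : ℕ → Γ_K` with `σ_ℓ ∈` stabiliser of `K[n/ℓ]` generating `Gal(K[n]/K[n/ℓ])`
  (`σ_mem`, `σ_gen`), and a transversal `S ⊆ Γ_K` of `Gal(K[n]/K)/Gal(K[n]/K[1]) = Gal(K[1]/K)` (`S_transversal`).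
* `fixedPointsOf H ≤ M` (fixed points of a subgroup in a module; `smul_mem_fixedPointsOf` for `H` normal) and the
  invariance of Kolyvagin's operators `KolyvaginOperator.derivOp_mem` / `derivOpProd_mem` / `derivedPoint_mem`.
* `NewformAbelianVariety.heckePointsOver D K t` (the Hecke action on `(A_g)_K(K̄)`), `…_smul`,
  `…_mem_geomTorsion`, `NewformAbelianVariety.idealTorsionMulOver D K I n = I · A_K[n]`.
* `ZhangLevelRaisedHeegnerData W K ι₀ N m p` — THE STRUCTURE (fields above); derived:
  `Z.ringClassPoints n = A_m(K[n]) ⊆ A_m(K̄)`, `Z.derivedPoint n kc = P_m(n)` (`derivedPoint_one`: `P_m(1) =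
  Σ_{s ∈ S} s y_m(1) = y_{m,K}`, (3.22)), `derivedPoint_mem` (`P_m(n) ∈ A_m(K[n])`), `Z.exists_root` (`A_m(K̄)` is
  `p`-divisible, from the tree's `AbelianVariety.nsmul_geomPoints_surjective_of_ne_zero`), `Z.IsLevelRaisedClassOf`,
  **`Z.levelRaisedClass hp n kc = c(n, m) ∈ H¹(K, E[p])`**, `levelRaisedClass_spec`,
  `levelRaisedClass_eq_of_isLevelRaisedClassOf`, `levelRaisedClass_eq_zero_of_not_existsUnique`.

## References

* [WZhang2014] W. Zhang, Camb. J. Math. 2 (2014) 191–253: Notations (iv)–(ix), (xii)–(xiv); Thm. 2.1 and p. 204;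
  §3.1–3.2 ((3.1)–(3.8), Remarks 6–7); §3.7 ((3.20)–(3.24)); §3.9 (Lemma 3.3, (3.28)–(3.30), Remarks 8–9); Thm. 4.3.
* [GrossLMS1991] B. H. Gross, *Kolyvagin's work on modular elliptic curves*, LMS LNS 153 (1991): §3 (`σ_ℓ`, `D_n`),
  §4 ((4.1) `P_n`, (4.2)–(4.4) the descended class, Lemma 4.3).
* [BertoliniDarmon2005] M. Bertolini, H. Darmon, Ann. of Math. 162 (2005): §2.2 (admissible primes), for context.
* [ShimuraIATAF1971] G. Shimura, Thm. 7.14 (the couple `(A_g, θ)`), via `NewformAbelianVariety.lean`.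
-/

noncomputable section

open scoped Classical

open CategoryTheory NumberField WeierstrassCurve
open Literature.AlgebraicGeometry.Motives (AbelianVariety)
open Literature.AlgebraicGeometry.Motives.AbelianVariety
open Literature.NumberTheory.EllipticCurves.ModularForms
open Literature.NumberTheory.GaloisRepresentations

universe u

namespace Literature.NumberTheory.EllipticCurves

/-! ## §1 Fixed points of a subgroup; invariance of Kolyvagin's operators -/

section FixedPoints

variable {G : Type*} [Group G] {M : Type*} [AddCommGroup M] [DistribMulAction G M]

/-- The **fixed points of a subgroup** `H ≤ G` in a `G`-module `M`, `M^H = {x | γ x = x ∀ γ ∈ H}`, as an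
additive subgroup (Serre, *Galois Cohomology*, I.§2.6, the module `A^H`; for `H = Gal(K̄/L)` acting on `A(K̄)`:
the `L`-rational points `A(L)`). [cite: SerreGaloisCohomology1997, I.§2.6 (A^H)] -/
def fixedPointsOf (H : Subgroup G) : AddSubgroup M where
  carrier := {x | ∀ γ ∈ H, γ • x = x}
  zero_mem' := fun γ _ ↦ smul_zero γ
  add_mem' := fun {a b} ha hb γ hγ ↦ by rw [smul_add, ha γ hγ, hb γ hγ]
  neg_mem' := fun {a} ha γ hγ ↦ by rw [smul_neg, ha γ hγ]

/-- Membership in `fixedPointsOf H` (definitional; Serre, *Galois Cohomology*, I.§2.6: the module `A^H`).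
[cite: SerreGaloisCohomology1997, I.§2.6 (A^H)] -/
theorem mem_fixedPointsOf_iff {H : Subgroup G} {x : M} :
    x ∈ fixedPointsOf (M := M) H ↔ ∀ γ ∈ H, γ • x = x :=
  Iff.rfl

/-- For a NORMAL subgroup `H ⊴ G` the fixed module `M^H` is `G`-stable: `δ x ∈ M^H` for `x ∈ M^H`
(`γ δ x = δ (δ⁻¹ γ δ) x`) — Serre, *Galois Cohomology*, I.§2.6: *"If `H` is a closed normal subgroup of `G` …
the group `G/H` acts on `A^H`"* (the inflation–restriction set-up). [cite: SerreGaloisCohomology1997, I.§2.6 (G/H acts on A^H)] -/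
theorem smul_mem_fixedPointsOf {H : Subgroup G} (hH : H.Normal) (δ : G) {x : M}
    (hx : x ∈ fixedPointsOf (M := M) H) : δ • x ∈ fixedPointsOf (M := M) H := by
  intro γ hγ
  have hmem : δ⁻¹ * γ * δ ∈ H := by simpa using hH.conj_mem γ hγ δ⁻¹
  calc γ • δ • x = δ • ((δ⁻¹ * γ * δ) • x) := by rw [mul_smul, mul_smul, smul_inv_smul]
    _ = δ • x := by rw [hx _ hmem]

end FixedPoints

namespace KolyvaginOperator

variable {G : Type*} [Monoid G] {A : Type*} [AddCommGroup A] (ρ : G →* AddMonoid.End A)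
  {F : AddSubgroup A} (hF : ∀ (g : G) {x : A}, x ∈ F → ρ g x ∈ F)
include hF

/-- `D_ℓ y ∈ F` for `y` in a subgroup `F` stable under every `ρ g` (e.g. `F = A(K[n])`, stable under `Γ_K` as
`K[n]/K` is Galois; Gross 1991, §3: `D_ℓ ∈ ℤ[G_ℓ]` acts on `E(K_n)`). [cite: GrossLMS1991, §3 (D_ℓ)] -/
theorem derivOp_mem (σ : G) (ℓ : ℕ) {y : A} (hy : y ∈ F) : derivOp ρ σ ℓ y ∈ F :=
  F.sum_mem fun i _ ↦ F.nsmul_mem (hF _ hy) i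

/-- `D_n y ∈ F` along any list of primes, for `F` stable under every `ρ g`. [cite: GrossLMS1991, §3 (D_n)] -/
theorem derivOpProd_mem (σ : ℕ → G) (L : List ℕ) {y : A} (hy : y ∈ F) : derivOpProd ρ σ L y ∈ F := by
  induction L with
  | nil => exact hy
  | cons ℓ L ih => exact derivOp_mem ρ hF (σ ℓ) ℓ ih

/-- **`P(n) = Σ_{s ∈ S} s (D_n y) ∈ F`** for `y ∈ F` and `F` stable under every `ρ g` (Gross 1991, (4.1):
`P_n ∈ E(K_n)`). [cite: GrossLMS1991, §4 (4.1)] -/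
theorem derivedPoint_mem (σ : ℕ → G) (n : ℕ) (S : Finset G) {y : A} (hy : y ∈ F) :
    derivedPoint ρ σ n S y ∈ F :=
  F.sum_mem fun s _ ↦ hF s (derivOpProd_mem ρ hF σ _ hy)

end KolyvaginOperator

/-! ## §2 The subgroups `Gal(K̄/K[d]) ∩ (lifts of Gal(K[n]/K))` of `Γ_K` and the Kolyvagin choices -/

section RingClass

variable (K : Type u) [Field K] [NumberField K] (ι₀ : K →+* ℂ)

/-- **The stabiliser in `Γ_K = Gal(K̄/K)` of `K[d] ∩ K[n]`**: the automorphisms `γ` of `K̄ = AlgebraicClosure K`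
over `K` with `γ(e(x)) = e(x)` for every `K`-embedding `e : K[n] → K̄` of the ring class field
`K[n] = ringClassField K ι₀ n ⊆ ℂ` and every `x ∈ K[n]` whose complex value lies in `K[d] = ringClassField K ι₀ d`
(all `K`-embeddings of the Galois extension `K[n]/K` have the same image, so quantifying over all of them makes
the subgroup choice-free and normal, `ringClassStabilizer_normal`). For `d = n` this is `Gal(K̄/K[n])`; for a prime
`ℓ ∣ n` and `d = n/ℓ` it is the preimage of `G_ℓ = Gal(K[n]/K[n/ℓ])` — Gross 1991, §3: *"the subgroup fixing the
subfield `K_{n/ℓ}`"*; Zhang 2014, §3.7: `G_n = Gal(K[n]/K[1]) ≅ ∏ G_ℓ`. Compare the tree's `ringClassGalOver ι₀ n d`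
(the same condition inside `Aut(K[n])`). [cite: WZhang2014, §3.7 (G_n, G_ℓ)] [cite: GrossLMS1991, §3 (G_ℓ)] -/
def ringClassStabilizer (n d : ℕ) : Subgroup (Field.absoluteGaloisGroup K) where
  carrier := {γ | ∀ (e : ringClassField K ι₀ n →ₐ[K] AlgebraicClosure K) (x : ringClassField K ι₀ n),
    ((x : ℂ) ∈ ringClassField K ι₀ d) → γ • e x = e x}
  one_mem' := fun e x _ ↦ one_smul _ _
  mul_mem' := fun {a b} ha hb e x hx ↦ by rw [mul_smul, hb e x hx, ha e x hx]
  inv_mem' := fun {a} ha e x hx ↦ by rw [inv_smul_eq_iff, ha e x hx]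

variable {K ι₀} in
/-- Membership in `ringClassStabilizer` (definitional). [cite: WZhang2014, §3.7 (G_n, G_ℓ)] -/
theorem mem_ringClassStabilizer_iff {n d : ℕ} {γ : Field.absoluteGaloisGroup K} :
    γ ∈ ringClassStabilizer K ι₀ n d ↔
      ∀ (e : ringClassField K ι₀ n →ₐ[K] AlgebraicClosure K) (x : ringClassField K ι₀ n),
        ((x : ℂ) ∈ ringClassField K ι₀ d) → γ • e x = e x :=
  Iff.rfl

variable {K ι₀} in
/-- `Gal(K̄/K[n]) ≤` the stabiliser of `K[d] ∩ K[n]` for every `d` (fixing all of `K[n]` fixes its elements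
lying in `K[d]`; Zhang 2014, §3.7: `G_ℓ ≤ G_n ≤ 𝒢_n`, all containing the identity of `Gal(K[n]/K)`).
[cite: WZhang2014, §3.7 (G_n, G_ℓ)] -/
theorem ringClassStabilizer_self_le (n d : ℕ) : ringClassStabilizer K ι₀ n n ≤ ringClassStabilizer K ι₀ n d :=
  fun _ hγ e x _ ↦ hγ e x x.2

/-- **`ringClassStabilizer K ι₀ n d` is normal in `Γ_K`** (conjugating by `δ` replaces the embedding `e` by
`δ⁻¹ ∘ e`, over which the defining condition also quantifies; reflects Gross 1991, §3: *"The field `K_n` is a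
Galois extension of `ℚ`"*, so `Gal(K̄/K_n) ⊴ Gal(K̄/K)`). A theorem, not an instance.
[cite: GrossLMS1991, §3 (K_n is Galois)] -/
theorem ringClassStabilizer_normal (n d : ℕ) : (ringClassStabilizer K ι₀ n d).Normal := by
  refine ⟨fun γ hγ δ e x hx ↦ ?_⟩
  let e' : ringClassField K ι₀ n →ₐ[K] AlgebraicClosure K :=
    ((Field.absoluteGaloisGroup.toAlgEquiv K δ⁻¹ : AlgebraicClosure K ≃ₐ[K] AlgebraicClosure K) :
      AlgebraicClosure K →ₐ[K] AlgebraicClosure K).comp e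
  have he' : ∀ y, δ⁻¹ • e y = e' y := fun _ ↦ rfl
  calc (δ * γ * δ⁻¹) • e x = δ • γ • e' x := by rw [mul_smul, mul_smul, he']
    _ = δ • δ⁻¹ • e x := by rw [hγ e' x hx, ← he']
    _ = e x := smul_inv_smul δ (e x)

/-- **`γ` and `δ` agree on `K[d] ∩ K[n]`**: `γ(e(x)) = δ(e(x))` for all `K`-embeddings `e : K[n] → K̄` and all
`x ∈ K[n]` with complex value in `K[d]` (`d = n`: same restriction to `K[n]`; `d = 1`: same restriction to the
Hilbert class field `K[1] ⊆ K[n]`, i.e. same coset of `G_n = Gal(K[n]/K[1])` in `𝒢_n = Gal(K[n]/K)`).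
[cite: WZhang2014, §3.7 (𝒢_n/G_n)] -/
def AgreeOnRingClass (n d : ℕ) (γ δ : Field.absoluteGaloisGroup K) : Prop :=
  ∀ (e : ringClassField K ι₀ n →ₐ[K] AlgebraicClosure K) (x : ringClassField K ι₀ n),
    ((x : ℂ) ∈ ringClassField K ι₀ d) → γ • e x = δ • e x

/-- **Kolyvagin's choices at conductor `n`** (Zhang 2014, §3.7, p. 212: *"Choose a generator `σ_ℓ` of `G_ℓ` …
Fix a set `𝒢` of representatives of `𝒢_n/G_n`"*; Gross 1991, §3–§4: *"Let `σ_ℓ` be a fixed generator of `G_ℓ`"*,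
*"Let `S` be a set of coset representatives for `G_n` in `𝒢_n`"*), recorded as LIFTS to `Γ_K = Gal(K̄/K)` (which
is what acts on `K̄`-points; only the restrictions to `K[n]` matter for points of `A(K[n])`):
* `σ ℓ ∈ Γ_K` fixing `K[n/ℓ]` (`σ_mem`) and generating `Gal(K[n]/K[n/ℓ])`: every `γ` fixing `K[n/ℓ]` agrees on
  `K[n]` with a power of `σ ℓ` (`σ_gen`), for the primes `ℓ ∣ n` (values of `σ` elsewhere are irrelevant);
* a finite `S ⊆ Γ_K` whose members represent each class of `Gal(K[n]/K)` modulo `Gal(K[n]/K[1])` exactly once: every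
  `γ ∈ Γ_K` agrees on `K[1]` with exactly one `s ∈ S` (`S_transversal`).
One such choice per conductor `n`, shared by all levels `m` (Zhang p. 220: *"We have also chosen the derivative
operators `D_n` compatibly when varying `m`"*), is why this is an argument of the derived objects below and not a
field of the level-`m` structure. [cite: WZhang2014, §3.7 (σ_ℓ, D_ℓ, 𝒢)] [cite: GrossLMS1991, §3–§4 (σ_ℓ, S)] -/
structure RingClassKolyvaginChoice (n : ℕ) : Type u where
  /-- Lifts to `Γ_K` of the generators `σ_ℓ` of `G_ℓ = Gal(K[n]/K[n/ℓ])`, `ℓ ∣ n`. -/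
  σ : ℕ → Field.absoluteGaloisGroup K
  /-- `σ_ℓ` fixes `K[n/ℓ]` for every prime `ℓ ∣ n`. -/
  σ_mem : ∀ ℓ ∈ n.primeFactors, σ ℓ ∈ ringClassStabilizer K ι₀ n (n / ℓ)
  /-- `σ_ℓ` generates `Gal(K[n]/K[n/ℓ])`: every `γ` fixing `K[n/ℓ]` acts on `K[n]` as a power of `σ_ℓ`. -/
  σ_gen : ∀ ℓ ∈ n.primeFactors, ∀ γ ∈ ringClassStabilizer K ι₀ n (n / ℓ),
    ∃ i : ℕ, AgreeOnRingClass K ι₀ n n γ (σ ℓ ^ i)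
  /-- Lifts to `Γ_K` of a set of representatives of `𝒢_n / G_n`, `G_n = Gal(K[n]/K[1])`. -/
  S : Finset (Field.absoluteGaloisGroup K)
  /-- `S` is a transversal: every `γ ∈ Γ_K` agrees on `K[1]` with exactly one `s ∈ S`. -/
  S_transversal : ∀ γ : Field.absoluteGaloisGroup K, ∃! s, s ∈ S ∧ AgreeOnRingClass K ι₀ n 1 s γ

end RingClass

/-! ## §3 The Hecke action on `(A_g)_K(K̄)` and `I · A_K[n]` -/

section HeckeOver

variable {N : ℕ} {g : CuspForm (CongruenceSubgroup.Gamma0 N) 2} (D : NewformAbelianVariety g)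
  (K : Type) [Field K] [NumberField K]

/-- The Hecke action of `t ∈ ℤ[{aₙ(g)}]` on the `K̄`-points of the base change `(A_g)_K` (`K̄ = AlgebraicClosure K`):
the endomorphism `θ(t)_K = θ(t) ×_ℚ K` (`AbelianVariety.Hom.baseChange`) acting on geometric points
(`Hom.geomPointsMap`). Zhang 2014, Notations (vii): the embedding `𝒪 ↪ End_ℚ(A)`; Diamond–Shurman §9.5. A
dot-notation extension of the tree's `NewformAbelianVariety` (namespace `…EllipticCurves.ModularForms`), declared
by its absolute name. [cite: WZhang2014, Notations (vii)] -/
def _root_.Literature.NumberTheory.EllipticCurves.ModularForms.NewformAbelianVariety.heckePointsOver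
    (t : coeffOrder g) : (D.A.baseChange K).geomPoints →+ (D.A.baseChange K).geomPoints :=
  Hom.geomPointsMap (Hom.baseChange K (D.hecke t : D.A ⟶ D.A))

/-- The Hecke action over `K` commutes with `Γ_K` (the endomorphisms are defined over `ℚ ⊆ K`;
`Hom.geomPointsMap_smul`; Diamond–Shurman §9.5: *"the action commutes with the action of `𝒪_f`"*).
[cite: DiamondShurman2005, §9.5 (before Lemma 9.5.3)] -/
theorem _root_.Literature.NumberTheory.EllipticCurves.ModularForms.NewformAbelianVariety.heckePointsOver_smul
    (t : coeffOrder g) (γ : Field.absoluteGaloisGroup K) (P : (D.A.baseChange K).geomPoints) :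
    D.heckePointsOver K t (γ • P) = γ • D.heckePointsOver K t P :=
  Hom.geomPointsMap_smul _ γ P

/-- The Hecke action preserves the `n`-torsion `A_K[n]` (additivity; Zhang 2014, Notations (vii): `𝒪` acts on
`A[𝔭^M]`, `ρ_{A,𝔭,M} : Gal_ℚ → Aut_{𝒪_𝔭}(A[𝔭^M])`). [cite: WZhang2014, Notations (vii)] -/
theorem _root_.Literature.NumberTheory.EllipticCurves.ModularForms.NewformAbelianVariety.heckePointsOver_mem_geomTorsion
    (t : coeffOrder g) {n : ℤ} {P : (D.A.baseChange K).geomPoints}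
    (hP : P ∈ (D.A.baseChange K).geomTorsion n) :
    D.heckePointsOver K t P ∈ (D.A.baseChange K).geomTorsion n := by
  rw [AbelianVariety.mem_geomTorsion_iff'] at hP ⊢
  rw [← map_zsmul, hP, map_zero]

/-- **`I · A_K[n] ⊆ A_K(K̄)`** for an ideal `I ⊆ ℤ[{aₙ(g)}]`: the subgroup generated by the points `θ(t) Q`,
`t ∈ I`, `Q ∈ A_K[n]` (for `I = 𝔭 ∋ p` and `n = p`: the kernel `𝔭 A[p]` of `A[p] → A[p] ⊗_{𝒪₀} 𝒪₀/𝔭`).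
[folklore] -/
def _root_.Literature.NumberTheory.EllipticCurves.ModularForms.NewformAbelianVariety.idealTorsionMulOver
    (I : Ideal (coeffOrder g)) (n : ℤ) : AddSubgroup (D.A.baseChange K).geomPoints :=
  AddSubgroup.closure {P | ∃ t ∈ I, ∃ Q ∈ (D.A.baseChange K).geomTorsion n, P = D.heckePointsOver K t Q}

/-- Generators of `I · A_K[n]`: `θ(t) Q ∈ I · A_K[n]` for `t ∈ I`, `Q ∈ A_K[n]` (Zhang 2014, Notations (vii),
the `𝒪`-module structure on torsion). [cite: WZhang2014, Notations (vii)] -/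
theorem _root_.Literature.NumberTheory.EllipticCurves.ModularForms.NewformAbelianVariety.heckePointsOver_mem_idealTorsionMulOver
    {I : Ideal (coeffOrder g)} {n : ℤ} {t : coeffOrder g} (ht : t ∈ I) {Q : (D.A.baseChange K).geomPoints}
    (hQ : Q ∈ (D.A.baseChange K).geomTorsion n) :
    D.heckePointsOver K t Q ∈ D.idealTorsionMulOver K I n :=
  AddSubgroup.subset_closure ⟨t, ht, Q, hQ, rfl⟩

end HeckeOver

/-! ## §4 The structure -/

section Main

variable (W : WeierstrassCurve ℚ) (K : Type) [Field K] [NumberField K] (ι₀ : K →+* ℂ)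
  (N m : ℕ) [NeZero N] [NeZero m] (p : ℕ)

/-- **W. Zhang's level-raised Kolyvagin data at level `N m`** for an elliptic curve `E = W/ℚ` (of conductor `N`;
`g = f_E`, `𝒪_g = ℤ`, `𝔭 = (p)`, `V = E[p]`), an imaginary quadratic field `K` embedded in `ℂ` by `ι₀` (for its
ring class fields `K[n] ⊆ ℂ`), a prime number `p` (any; `p = 3` allowed) and a positive integer `m` (intended: a
square-free product of level-raising primes coprime to `N D p` with `ν(N⁻m)` even — NOT enforced). Camb. J. Math.
2 (2014): Thm. 2.1 and p. 204, Notations (vi)–(ix), §3.2, §3.7, §3.9 (3.29)–(3.30), Remarks 8–9. FIELDS (each a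
DEFINING property of the printed objects; module docstring for the verbatim quotes and the dictionary):
* `g`, `isNewform` — *"a weight-two newform `g_m` of level `N m`"* (trivial nebentypus: `Γ₀(N m)`);
* `𝔭`, `natCast_mem`, `one_not_mem`, `exists_int_sub_mem` — the prime `𝔭_{m,0}` of `𝒪_{g_m,0} = ℤ[{aₙ(g_m)}]`
  (`coeffOrder g`) above `p` with residue field `k₀ = 𝔽_p`;
* `coeff_sub_mem` — *"for all primes `ℓ ≠ q`, `a_ℓ(g) mod 𝔭 ≡ a_ℓ(g') mod 𝔭'`"*, recorded for the primes
  `ℓ ∤ N m p`, `a_ℓ(E) = WeierstrassCurve.LFunction W ℓ`;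
* `av` — *"`A_m = A_{g_m}`"*, the GL₂-type abelian variety over `ℚ` with `𝒪_{g_m,0} ↪ End_ℚ(A_m)` (tree interface
  `NewformAbelianVariety`);
* `ι`, `ι_smul`, `ι_hecke`, `ι_surjective`, `mem_of_ι_eq_zero` — the identification
  `A_m(K̄)[p] ↠ A_m[p]/𝔭_{m,0}A_m[p] ≃ E(K̄)[p]` of `𝔽_p[Γ_K]`-modules ((3.29) *"`J(X_m)[𝔪_m] ≃ V ≃ A⁰_{g_m}[𝔭_{m,0}]`"*,
  Remark 9 *"identifying `A[𝔭] ≃ V ⊗_{k₀} k`"*; quotient form, module docstring "DESIGN");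
* `y`, `smul_y` — *"`y_m(n) ∈ A_m(K[n])`"*, `n ∈ ℕ` (the Heegner points of conductor `n`, (3.2); values at
  `n ∉ Λ` irrelevant), as points of `A_m(K̄)` fixed by `Gal(K̄/K[n])`.
Existence of such data (level raising Thm. 2.1, Shimura's construction, Helm's multiplicity one Lemma 3.3, CM
theory for `y_m(n)`) is NOT asserted; nothing about the Shimura curve `X_{N⁺,N⁻m}` is recorded. Derived objects:
`ringClassPoints`, `derivedPoint` (`P_m(n)`), `levelRaisedClass` (`c(n, m) ∈ H¹(K, E[p])`).
[cite: WZhang2014, Thm. 2.1 and p. 204; Notations (vi)–(ix); §3.2 (3.2); §3.9 (3.29)–(3.30), Remarks 8–9] -/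
structure ZhangLevelRaisedHeegnerData : Type 1 where
  /-- The level-raised newform `g_m ∈ S₂(Γ₀(N m))` (weight two, trivial nebentypus). -/
  g : CuspForm (CongruenceSubgroup.Gamma0 (N * m)) 2
  /-- `g_m` is a newform of level `N m` (new, normalised Hecke eigenform). -/
  isNewform : IsNewform0 g
  /-- The prime `𝔭_{m,0}` of the coefficient order `ℤ[{aₙ(g_m)}] = 𝒪_{g_m,0}`. -/
  𝔭 : Ideal (coeffOrder g)
  /-- `𝔭_{m,0}` lies above `p`: `p ∈ 𝔭_{m,0}`. -/
  natCast_mem : (p : coeffOrder g) ∈ 𝔭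
  /-- `𝔭_{m,0}` is a proper ideal. -/
  one_not_mem : (1 : coeffOrder g) ∉ 𝔭
  /-- The residue field `k_{m,0} = 𝒪_{g_m,0}/𝔭_{m,0}` is the prime field `𝔽_p`: every residue class has an integer
  representative. -/
  exists_int_sub_mem : ∀ a : coeffOrder g, ∃ r : ℤ, a - (r : coeffOrder g) ∈ 𝔭
  /-- The congruence `a_ℓ(g_m) ≡ a_ℓ(E) (mod 𝔭_{m,0})` at every prime `ℓ ∤ N m p`. -/
  coeff_sub_mem : ∀ ℓ : ℕ, ℓ.Prime → ¬ ℓ ∣ N * m * p →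
    coeffOrder.coeff g ℓ - ((W.LFunction ℓ : ℤ) : coeffOrder g) ∈ 𝔭
  /-- The abelian variety `A_m = A_{g_m}` over `ℚ` with its Hecke action (Shimura's couple). -/
  av : NewformAbelianVariety g
  /-- The identification `ι_m : A_m(K̄)[p] ↠ A_m[p]/𝔭_{m,0}A_m[p] ≃ E(K̄)[p]`. -/
  ι : (av.A.baseChange K).geomTorsion (p : ℤ) →+ geomTorsion (W.baseChange K) (p : ℤ)
  /-- `ι_m` is `Γ_K`-equivariant. -/
  ι_smul : ∀ (γ : Field.absoluteGaloisGroup K) (x : (av.A.baseChange K).geomTorsion (p : ℤ)),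
    ι (γ • x) = γ • ι x
  /-- `ι_m` kills `𝔭_{m,0} · A_m[p]` (it is `𝒪_{g_m,0}`-semilinear for `𝒪_{g_m,0} → k_{m,0} = 𝔽_p`). -/
  ι_hecke : ∀ t ∈ 𝔭, ∀ x : (av.A.baseChange K).geomTorsion (p : ℤ),
    ι ⟨av.heckePointsOver K t x, av.heckePointsOver_mem_geomTorsion K t x.2⟩ = 0
  /-- `ι_m` is onto `E[p]`. -/
  ι_surjective : Function.Surjective ι
  /-- The kernel of `ι_m` is contained in (hence equal to) `𝔭_{m,0} · A_m[p]`. -/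
  mem_of_ι_eq_zero : ∀ x : (av.A.baseChange K).geomTorsion (p : ℤ), ι x = 0 →
    (x : (av.A.baseChange K).geomPoints) ∈ av.idealTorsionMulOver K 𝔭 (p : ℤ)
  /-- The Heegner points `y_m(n) ∈ A_m(K̄)`, `n ∈ ℕ` (values at `n` outside `Λ` are irrelevant). -/
  y : ℕ → (av.A.baseChange K).geomPoints
  /-- `y_m(n)` is rational over the ring class field `K[n]`: fixed by `Gal(K̄/K[n])`. -/
  smul_y : ∀ (n : ℕ), ∀ γ ∈ ringClassStabilizer K ι₀ n n, γ • y n = y n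

namespace ZhangLevelRaisedHeegnerData

variable {W K ι₀ N m p} (Z : ZhangLevelRaisedHeegnerData W K ι₀ N m p)

/-- `𝔭_{m,0}` is not the unit ideal (Zhang 2014, Notations (vi): `𝔭₀ = 𝔭 ∩ 𝒪₀`, a prime).
[cite: WZhang2014, Notations (vi)] -/
theorem 𝔭_ne_top : Z.𝔭 ≠ ⊤ := fun h ↦ Z.one_not_mem (h ▸ Submodule.mem_top)

/-- **`A_m(K[n]) ⊆ A_m(K̄)`**: the points fixed by `Gal(K̄/K[n])` (Zhang 2014, §3.2: `y_m(n) ∈ A_m(K[n])`; Gross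
1991, §4: `E(K_n)`, the group in which `D_n` and `P_n` live). [cite: WZhang2014, §3.2 (A_m(K[n]))] -/
def ringClassPoints (n : ℕ) : AddSubgroup (Z.av.A.baseChange K).geomPoints :=
  fixedPointsOf (ringClassStabilizer K ι₀ n n)

/-- Membership in `A_m(K[n])` (definitional). [cite: WZhang2014, §3.2 (A_m(K[n]))] -/
theorem mem_ringClassPoints_iff {n : ℕ} {P : (Z.av.A.baseChange K).geomPoints} :
    P ∈ Z.ringClassPoints n ↔ ∀ γ ∈ ringClassStabilizer K ι₀ n n, γ • P = P :=
  Iff.rfl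

/-- `y_m(n) ∈ A_m(K[n])` (the field `smul_y`). [cite: WZhang2014, §3.2 (y_m(n) ∈ A_m(K[n]))] -/
theorem y_mem_ringClassPoints (n : ℕ) : Z.y n ∈ Z.ringClassPoints n :=
  Z.smul_y n

/-- `A_m(K[n])` is `Γ_K`-stable (`K[n]/K` is Galois: `ringClassStabilizer_normal`; Gross 1991, Lemma 4.3 /
McCallum 1991, (5): the `𝒢_n`-module `E(K_n)`). [cite: GrossLMS1991, §4 (E(K_n) as a 𝒢_n-module)] -/
theorem smul_mem_ringClassPoints {n : ℕ} (δ : Field.absoluteGaloisGroup K) {P : (Z.av.A.baseChange K).geomPoints}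
    (hP : P ∈ Z.ringClassPoints n) : δ • P ∈ Z.ringClassPoints n :=
  smul_mem_fixedPointsOf (ringClassStabilizer_normal K ι₀ n n) δ hP

/-- **The derived Heegner point `P_m(n) = Σ_{s ∈ 𝒢} s(D_n y_m(n)) ∈ A_m(K̄)`** (Zhang 2014, §3.7 p. 212, for the
points `y_m(n)` of §3.2 and the choices `kc = (σ_ℓ, 𝒢)` at conductor `n`): the tree's generic
`KolyvaginOperator.derivedPoint` for the action `galActHom` of `Γ_K` on `A_m(K̄)` (`D_n` taken along the increasing
list of prime factors of `n`). [cite: WZhang2014, §3.7 (P(n))] -/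
def derivedPoint (n : ℕ) (kc : RingClassKolyvaginChoice K ι₀ n) : (Z.av.A.baseChange K).geomPoints :=
  KolyvaginOperator.derivedPoint (Z.av.A.baseChange K).galActHom kc.σ n kc.S (Z.y n)

/-- **`P_m(1) = Σ_{s ∈ 𝒢} s y_m(1) = tr_{K[1]/K} y_m(1) = y_{m,K}`** (Zhang 2014, (3.22): *"`y_K := P(1) =
tr_{K[1]/K} y(1) ∈ A(K)` … the Heegner point"*). [cite: WZhang2014, §3.7 (3.22)] -/
theorem derivedPoint_one (kc : RingClassKolyvaginChoice K ι₀ 1) :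
    Z.derivedPoint 1 kc = ∑ s ∈ kc.S, s • Z.y 1 :=
  KolyvaginOperator.derivedPoint_one _ _ _ _

/-- **`P_m(n) ∈ A_m(K[n])`** (Zhang 2014, §3.7: `P(n) ∈ A_g(K[n])`): `A_m(K[n])` is a `Γ_K`-stable subgroup
containing `y_m(n)`, and `D_n`, `Σ_{s ∈ 𝒢} s` preserve it. [cite: WZhang2014, §3.7 (P(n) ∈ A_g(K[n]))] -/
theorem derivedPoint_mem (n : ℕ) (kc : RingClassKolyvaginChoice K ι₀ n) :
    Z.derivedPoint n kc ∈ Z.ringClassPoints n :=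
  KolyvaginOperator.derivedPoint_mem _ (fun δ _ hx ↦ Z.smul_mem_ringClassPoints δ hx) _ _ _
    (Z.y_mem_ringClassPoints n)

/-- `P_m(n)` is fixed by `Gal(K̄/K[n])`. [cite: WZhang2014, §3.7 (P(n) ∈ A_g(K[n]))] -/
theorem smul_derivedPoint {n : ℕ} (kc : RingClassKolyvaginChoice K ι₀ n) {γ : Field.absoluteGaloisGroup K}
    (hγ : γ ∈ ringClassStabilizer K ι₀ n n) : γ • Z.derivedPoint n kc = Z.derivedPoint n kc :=
  Z.derivedPoint_mem n kc γ hγ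

/-- **`A_m(K̄)` is `p`-divisible** (`p ≠ 0`): every point has a `p`-th root (Mumford, *Abelian Varieties*, §6
Application 2, p. 64: *"`X(k)` is a divisible group"*; the tree's theorem
`AbelianVariety.nsmul_geomPoints_surjective_of_ne_zero`). [cite: MumfordAV1970, §6 Application 2 (p. 64)] -/
theorem exists_root (hp : p ≠ 0) (P : (Z.av.A.baseChange K).geomPoints) :
    ∃ Q : (Z.av.A.baseChange K).geomPoints, (p : ℤ) • Q = P := by
  obtain ⟨Q, hQ⟩ := AbelianVariety.nsmul_geomPoints_surjective_of_ne_zero (A := Z.av.A.baseChange K) p hp P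
  exact ⟨Q, by rw [natCast_zsmul]; exact hQ⟩

/-- A chosen `p`-th root `P/p ∈ A_m(K̄)` of `P` (Zhang 2014, §3.7: the Kummer map; Gross 1991, (4.6): *"a fixed
`p`-th root of `P_n` in `E(K̄)`"*). [cite: GrossLMS1991, §4 (4.6)] -/
def root (hp : p ≠ 0) (P : (Z.av.A.baseChange K).geomPoints) : (Z.av.A.baseChange K).geomPoints :=
  (Z.exists_root hp P).choose

/-- `p • (P/p) = P` (the defining property of the chosen root). [cite: MumfordAV1970, §6 Application 2 (p. 64)] -/
theorem zsmul_root (hp : p ≠ 0) (P : (Z.av.A.baseChange K).geomPoints) : (p : ℤ) • Z.root hp P = P :=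
  (Z.exists_root hp P).choose_spec

/-- For `γ` fixing `P` and `pQ = P`, the Kummer value `γQ − Q` is `p`-torsion (McCallum 1991, proof of
Lemma 4.1: *"Clearly it takes values in `E_{p^M}`"*; Silverman, *AEC*, VIII.§2). [cite: McCallumLMS1991, Lemma 4.1] -/
theorem smul_sub_mem_geomTorsion {P Q : (Z.av.A.baseChange K).geomPoints} (hQ : (p : ℤ) • Q = P)
    {γ : Field.absoluteGaloisGroup K} (hγ : γ • P = P) :
    γ • Q - Q ∈ (Z.av.A.baseChange K).geomTorsion (p : ℤ) := by
  rw [AbelianVariety.mem_geomTorsion_iff', zsmul_sub, ← KolyvaginCocycle.smul_zsmul_comm, hQ, hγ, sub_self]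

/-- **`c ∈ H¹(K, E[p])` is the level-raised class of the point `P ∈ A_m(K[n])`** (with chosen root `Q`, `pQ = P`):
`c` is represented by a continuous cocycle `φ : Γ_K → E(K̄)[p]` whose restriction to `Gal(K̄/K[n])` is the Kummer
cocycle of `P` pushed through `ι_m`, `φ(h) = ι_m(hQ − Q)`. Equivalently `Res_{K[n]} c = ι_{m,*} δ(P)` in
`H¹(K[n], E[p])` — Gross 1991, (4.4): *"Let `c(n)` be the unique class in `H¹(K, E_p)` such that
`Res c(n) = δ_n [P_n]`"*; Zhang 2014, (3.21)/(3.30): *"the Kummer image of `P(n)` descends to a cohomology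
class"*, *"the derived cohomological class from the Heegner point"*, valued in `H¹(K, A⁰_{g_m}[𝔭_{m,0}]) ≃ H¹(K, V)`.
[cite: WZhang2014, §3.7 (3.21) and §3.9 (3.30)] [cite: GrossLMS1991, §4 (4.4)] -/
def IsLevelRaisedClassOf (n : ℕ) (P Q : (Z.av.A.baseChange K).geomPoints) (hQ : (p : ℤ) • Q = P)
    (hP : P ∈ Z.ringClassPoints n) (c : galH1Torsion (W.baseChange K) (p : ℤ)) : Prop :=
  ∃ φ : contOneCocycles (discreteTopRep (Field.absoluteGaloisGroup K) (geomTorsion (W.baseChange K) (p : ℤ))),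
    oneCocycleClass _ φ = c ∧
      ∀ (γ : Field.absoluteGaloisGroup K) (hγ : γ ∈ ringClassStabilizer K ι₀ n n),
        φ.1 γ = Z.ι ⟨γ • Q - Q, Z.smul_sub_mem_geomTorsion hQ (hP γ hγ)⟩

/-- **The level-raised Kolyvagin class `c(n, m) ∈ H¹(K, E[p])`** (Zhang 2014, §3.9 (3.30); §3.7 (3.21) with
`M = 1`; Remark 9) of the data `Z` at level `m`, for the Kolyvagin conductor `n` and the choices `kc = (σ_ℓ, 𝒢)`:
THE class `c` with `IsLevelRaisedClassOf n P_m(n) (P_m(n)/p) c` — the unique class in `H¹(K, E[p])` restricting on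
`Gal(K̄/K[n])` to the `ι_m`-image of the Kummer class of the derived point `P_m(n)` — when it exists uniquely
(which is the case under the printed hypotheses: `E(K[n])[p] = 0`, Gross Lemma 4.3 / Zhang p. 212
`A_{g,1}^{Gal K[n]} = 0`, and `𝒢_n`-invariance of the Kummer image, `n ∈ Λ`), and the JUNK value `0` otherwise.
Lives in the tree's `H¹(K, E[p]) = galH1Torsion (W.baseChange K) p`, the ambient group of the elliptic curve's own
classes `c(n) = c(n, 1)`, so that the reciprocity law (Thm. 4.3: `loc_{q₁} c(n, m) = loc_{q₂} c(n, m q₁ q₂)`), the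
base case (Thm. 7.2) and the triangulation (Lemma 8.4) are statements about THESE classes; as printed they hold
up to units of `k₀ = 𝔽_p` (Remark 8, Thm. 4.3). [cite: WZhang2014, §3.9 (3.30), §3.7 (3.21), Remarks 8–9] -/
def levelRaisedClass (hp : p.Prime) (n : ℕ) (kc : RingClassKolyvaginChoice K ι₀ n) :
    galH1Torsion (W.baseChange K) (p : ℤ) :=
  if h : ∃! c, Z.IsLevelRaisedClassOf n (Z.derivedPoint n kc) (Z.root hp.ne_zero (Z.derivedPoint n kc))
      (Z.zsmul_root hp.ne_zero _) (Z.derivedPoint_mem n kc) c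
  then h.choose else 0

/-- When the descended class exists uniquely, `c(n, m)` IS it. [cite: WZhang2014, §3.7 (3.21)] -/
theorem levelRaisedClass_spec (hp : p.Prime) (n : ℕ) (kc : RingClassKolyvaginChoice K ι₀ n)
    (h : ∃! c, Z.IsLevelRaisedClassOf n (Z.derivedPoint n kc) (Z.root hp.ne_zero (Z.derivedPoint n kc))
      (Z.zsmul_root hp.ne_zero _) (Z.derivedPoint_mem n kc) c) :
    Z.IsLevelRaisedClassOf n (Z.derivedPoint n kc) (Z.root hp.ne_zero (Z.derivedPoint n kc))
      (Z.zsmul_root hp.ne_zero _) (Z.derivedPoint_mem n kc) (Z.levelRaisedClass hp n kc) := by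
  rw [levelRaisedClass, dif_pos h]
  exact h.choose_spec.1

/-- Uniqueness: any class with the descent property is `c(n, m)` (when unique existence holds).
[cite: GrossLMS1991, §4 (4.4) ("the unique class")] -/
theorem levelRaisedClass_eq_of_isLevelRaisedClassOf (hp : p.Prime) (n : ℕ) (kc : RingClassKolyvaginChoice K ι₀ n)
    (h : ∃! c, Z.IsLevelRaisedClassOf n (Z.derivedPoint n kc) (Z.root hp.ne_zero (Z.derivedPoint n kc))
      (Z.zsmul_root hp.ne_zero _) (Z.derivedPoint_mem n kc) c)
    {c : galH1Torsion (W.baseChange K) (p : ℤ)}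
    (hc : Z.IsLevelRaisedClassOf n (Z.derivedPoint n kc) (Z.root hp.ne_zero (Z.derivedPoint n kc))
      (Z.zsmul_root hp.ne_zero _) (Z.derivedPoint_mem n kc) c) :
    c = Z.levelRaisedClass hp n kc :=
  h.unique hc (Z.levelRaisedClass_spec hp n kc h)

/-- The junk branch of the definition rendering (3.21): without unique existence of the descended class,
`c(n, m) = 0`. [cite: WZhang2014, §3.7 (3.21)] -/
theorem levelRaisedClass_eq_zero_of_not_existsUnique (hp : p.Prime) (n : ℕ)
    (kc : RingClassKolyvaginChoice K ι₀ n)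
    (h : ¬ ∃! c, Z.IsLevelRaisedClassOf n (Z.derivedPoint n kc) (Z.root hp.ne_zero (Z.derivedPoint n kc))
      (Z.zsmul_root hp.ne_zero _) (Z.derivedPoint_mem n kc) c) :
    Z.levelRaisedClass hp n kc = 0 := by
  rw [levelRaisedClass, dif_neg h]

end ZhangLevelRaisedHeegnerData

end Main

end Literature.NumberTheory.EllipticCurves

end
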